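import Literature.NumberTheory.Transcendental.KZKernelConjectureForms
import Literature.NumberTheory.Transcendental.KZSubcalculusInvariants
import Literature.NumberTheory.Transcendental.KZCalculusProofs
import Literature.NumberTheory.Transcendental.SemialgebraicMapsProofs

/-!
# The first-coordinate distribution function of the KZ calculus (invariant of rules (1a), (1b), and (3) over positive-dimensional bases)

Support for the negative side of crux `CompleteModGammaSector` (§§5B–5C of
`Cruxes/CompleteModGammaSector/Disproof.lean`, cdisprove gen 1). `Cdf c q = KZ.restrictedEval
(halfWindow q) c`: on a positive-dimensional generator `[σ,f]`, `q ↦ ∫_{σ ∩ {x₀ ≤ q}} f`; `0` in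
dimension `0`. `WindowSemialg g`: `g (2 + s)` agrees for `s ∈ [0,1]` with an `ℝ`-semialgebraic
function; `covKer` = the subgroup of formal combinations with window-semialgebraic `Cdf`.

* `closure_add_le_covKer` — rules (1a), (1b) preserve `Cdf` pointwise;
* `setIntegral_band_restrict` — the tree's Newton–Leibniz soundness computation (Fubini along the
  last coordinate + FTC on each fibre) LOCALISED to an arbitrary measurable set of base points;
* `Cdf_eq_of_newtonLeibniz_succ` — rule (3) over a base of positive dimension preserves `Cdf`.
-/

noncomputable section

open MeasureTheory Set
open scoped BigOperators Topology

namespace Summit.KontsevichZagierPeriods.CompleteModGammaSectorNegative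

open Literature.NumberTheory.Transcendental
open Literature.NumberTheory.Transcendental.KZ
open Literature.ModelTheory.ExponentialFields (IsSemialgebraic)

/-! ### §5B The invariant: first-coordinate distribution function modulo ℝ-semialgebraic functions -/

/-- Window family: the half-space `{x₀ ≤ q}` in positive dimension, nothing in dimension `0`. -/
def halfWindow (q : ℝ) : (n : ℕ) → Set (Fin n → ℝ)
  | 0 => ∅
  | _ + 1 => {x | x 0 ≤ q}

/-- The windows are measurable. [folklore] -/
theorem measurableSet_halfWindow (q : ℝ) : ∀ n, MeasurableSet (halfWindow q n)
  | 0 => MeasurableSet.empty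
  | _ + 1 => measurableSet_le (measurable_pi_apply 0) measurable_const

/-- **First-coordinate distribution function** `Cdf c q = restrictedEval (halfWindow q) c`:
on a generator `[σ, f]` of positive dimension, `q ↦ ∫_{σ ∩ {x₀ ≤ q}} f`; `0` in dimension `0`.
[folklore] -/
def Cdf : FormalRep →+ (ℝ → ℝ) := AddMonoidHom.pi fun q => restrictedEval (halfWindow q)

/-- Pointwise formula. [folklore] -/
theorem Cdf_apply (c : FormalRep) (q : ℝ) : Cdf c q = restrictedEval (halfWindow q) c := rfl

/-- `Cdf` of a positive-dimensional generator. [folklore] -/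
theorem Cdf_of_succ {n : ℕ} (r : IntegralRep (n + 1)) (q : ℝ) :
    Cdf (of r) q = ∫ x in r.domain ∩ {x | x 0 ≤ q}, r.integrand x := by
  rw [Cdf_apply, restrictedEval_of]
  rfl

/-- `Cdf` of a dimension-`0` generator vanishes. [folklore] -/
theorem Cdf_of_zero (r : IntegralRep 0) : Cdf (of r) = 0 := by
  funext q
  rw [Cdf_apply, restrictedEval_of]
  simp [halfWindow]

/-- Index-robust form of `Cdf_of_zero`. [folklore] -/
theorem Cdf_of_eq_zero {n : ℕ} (hn : n = 0) (r : IntegralRep n) : Cdf (of r) = 0 := by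
  subst hn
  exact Cdf_of_zero r

/-- Index-robust evaluation: if every point of the domain has first coordinate `≤ q`, then
`Cdf [r] q = r.value`. [folklore] -/
theorem Cdf_of_eq_value {n : ℕ} (hn : 0 < n) (r : IntegralRep n) (q : ℝ)
    (hq : ∀ x ∈ r.domain, x ⟨0, hn⟩ ≤ q) : Cdf (of r) q = r.value := by
  obtain ⟨m, rfl⟩ := Nat.exists_eq_succ_of_ne_zero hn.ne'
  have hset : r.domain ∩ {x : Fin (m + 1) → ℝ | x 0 ≤ q} = r.domain :=
    inter_eq_left.mpr fun x hx => by simpa using hq x hx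
  rw [Cdf_of_succ, IntegralRep.value, hset]

/-- `g` agrees on the window `q = 2 + s`, `s ∈ [0, 1]`, with an `ℝ`-semialgebraic function of `s`. -/
def WindowSemialg (g : ℝ → ℝ) : Prop :=
  ∃ G : (Fin 1 → ℝ) → ℝ, IsSemialgebraicFunOn ℝ {x | x 0 ∈ Icc (0 : ℝ) 1} G ∧
    ∀ s ∈ Icc (0 : ℝ) 1, g (2 + s) = G (fun _ => s)

/-- The unit interval `[0,1] ⊆ ℝ¹` is `ℝ`-semialgebraic. [folklore] -/
theorem isSemialgebraic_window : IsSemialgebraic ℝ {x : Fin 1 → ℝ | x 0 ∈ Icc (0 : ℝ) 1} := by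
  have h : {x : Fin 1 → ℝ | x 0 ∈ Icc (0 : ℝ) 1} =
      {x : Fin 1 → ℝ | MvPolynomial.aeval x (MvPolynomial.C 0 : MvPolynomial (Fin 1) ℝ) ≤
          MvPolynomial.aeval x (MvPolynomial.X 0 : MvPolynomial (Fin 1) ℝ)} ∩
        {x | MvPolynomial.aeval x (MvPolynomial.X 0 : MvPolynomial (Fin 1) ℝ) ≤
          MvPolynomial.aeval x (MvPolynomial.C 1 : MvPolynomial (Fin 1) ℝ)} := by
    ext x
    simp
  rw [h]
  exact (Literature.ModelTheory.ExponentialFields.isSemialgebraic_setOf_eval_le _ _).inter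
    (Literature.ModelTheory.ExponentialFields.isSemialgebraic_setOf_eval_le _ _)

/-- Real constants are `ℝ`-semialgebraic functions on the window. [folklore] -/
theorem windowSemialg_const_fun (c : ℝ) :
    IsSemialgebraicFunOn ℝ {x : Fin 1 → ℝ | x 0 ∈ Icc (0 : ℝ) 1} (fun _ => c) :=
  (isSemialgebraicFunOn_aeval isSemialgebraic_window (MvPolynomial.C c)).congr fun x _ => by simp

/-- A function constant on the window is window-semialgebraic. [folklore] -/
theorem WindowSemialg.of_const {g : ℝ → ℝ} (c : ℝ) (h : ∀ s ∈ Icc (0 : ℝ) 1, g (2 + s) = c) :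
    WindowSemialg g :=
  ⟨fun _ => c, windowSemialg_const_fun c, h⟩

/-- `0` is window-semialgebraic. [folklore] -/
theorem WindowSemialg.zero : WindowSemialg 0 := WindowSemialg.of_const 0 fun _ _ => rfl

/-- Window-semialgebraic functions are closed under addition (Tarski–Seidenberg, tree:
`IsSemialgebraicFunOn.add_holds`). [folklore] -/
theorem WindowSemialg.add {g h : ℝ → ℝ} (hg : WindowSemialg g) (hh : WindowSemialg h) :
    WindowSemialg (g + h) := by
  obtain ⟨G, hG, hgG⟩ := hg
  obtain ⟨H, hH, hhH⟩ := hh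
  refine ⟨G + H, IsSemialgebraicFunOn.add_holds hG hH, fun s hs => ?_⟩
  simp [hgG s hs, hhH s hs]

/-- Window-semialgebraic functions are closed under negation. [folklore] -/
theorem WindowSemialg.neg {g : ℝ → ℝ} (hg : WindowSemialg g) : WindowSemialg (-g) := by
  obtain ⟨G, hG, hgG⟩ := hg
  refine ⟨-G, hG.neg, fun s hs => ?_⟩
  simp [hgG s hs]

/-- **The invariant subgroup**: formal combinations whose first-coordinate distribution function
is `ℝ`-semialgebraic on the window `[2, 3]`. [folklore] -/
def covKer : AddSubgroup FormalRep where
  carrier := {c | WindowSemialg (Cdf c)}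
  zero_mem' := by
    show WindowSemialg (Cdf 0)
    rw [map_zero]
    exact WindowSemialg.zero
  add_mem' := by
    intro a b ha hb
    show WindowSemialg (Cdf (a + b))
    rw [map_add]
    exact WindowSemialg.add ha hb
  neg_mem' := by
    intro a ha
    show WindowSemialg (Cdf (-a))
    rw [map_neg]
    exact WindowSemialg.neg ha

/-- Membership in `covKer`. [folklore] -/
theorem mem_covKer_iff {c : FormalRep} : c ∈ covKer ↔ WindowSemialg (Cdf c) := Iff.rfl

/-- Rules (1a), (1b) lie in `covKer`: they preserve every restricted evaluation, hence `Cdf`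
pointwise (tree: `closure_add_le_ker_restrictedEval`). [cite: KontsevichZagier2001, §1.2 rule (1)] -/
theorem closure_add_le_covKer :
    AddSubgroup.closure (domainAddRel ∪ integrandAddRel) ≤ covKer := by
  intro c hc
  rw [mem_covKer_iff]
  have h0 : Cdf c = 0 := by
    funext q
    rw [Cdf_apply]
    exact closure_add_le_ker_restrictedEval _ (measurableSet_halfWindow q) hc
  rw [h0]
  exact WindowSemialg.zero

/-! ### §5C Newton–Leibniz over a positive-dimensional base preserves `Cdf` -/

/-- **Restricted soundness of the Newton–Leibniz move.** For a move of rule (3) (band over `τ`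
with bounds `a ≤ b` and fibrewise primitive `F`) and ANY measurable set `S` of base points,
`∫_{band ∩ init⁻¹ S} ∂F/∂t = ∫_{τ ∩ S} (F(x,b x) − F(x,a x))` — the tree's soundness computation
(`eval_eq_zero_of_mem_newtonLeibnizRel_holds`: Fubini along the last coordinate + FTC on each
fibre) localised to `S`; `S` need not be semialgebraic. [cite: KontsevichZagier2001, §1.2 rule (3)] -/
theorem setIntegral_band_restrict {n : ℕ} (r : IntegralRep (n + 1)) (r' : IntegralRep n)
    {a b : (Fin n → ℝ) → ℝ} {F : (Fin (n + 1) → ℝ) → ℝ}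
    (hab : ∀ x ∈ r'.domain, a x ≤ b x)
    (hdom : r.domain = {z | (Fin.init z : Fin n → ℝ) ∈ r'.domain ∧ a (Fin.init z) ≤ z (Fin.last n) ∧
      z (Fin.last n) ≤ b (Fin.init z)})
    (hcont : ∀ x ∈ r'.domain, ContinuousOn (fun t : ℝ => F (Fin.snoc x t)) (Icc (a x) (b x)))
    (hderiv : ∀ x ∈ r'.domain, ∀ t ∈ Ioo (a x) (b x),
      HasDerivAt (fun s : ℝ => F (Fin.snoc x s)) (r.integrand (Fin.snoc x t)) t)
    {S : Set (Fin n → ℝ)} (hS : MeasurableSet S) :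
    ∫ z in r.domain ∩ {z | Fin.init z ∈ S}, r.integrand z =
      ∫ x in r'.domain ∩ S, (F (Fin.snoc x (b x)) - F (Fin.snoc x (a x))) := by
  have hτm : MeasurableSet (r'.domain ∩ S) := (IntegralRep.measurableSet_domain_holds r').inter hS
  have hinit : Measurable (Fin.init : (Fin (n + 1) → ℝ) → Fin n → ℝ) :=
    measurable_pi_lambda _ fun i => measurable_pi_apply _
  have hbm : MeasurableSet (r.domain ∩ {z | Fin.init z ∈ S}) :=
    (IntegralRep.measurableSet_domain_holds r).inter (hS.preimage hinit)
  -- split off the last coordinate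
  set e : (Fin (n + 1) → ℝ) ≃ᵐ ℝ × (Fin n → ℝ) :=
    MeasurableEquiv.piFinSuccAbove (fun _ => ℝ) (Fin.last n) with he_def
  have he : MeasurePreserving e volume volume :=
    volume_preserving_piFinSuccAbove (fun _ => ℝ) (Fin.last n)
  have he_symm : ∀ p : ℝ × (Fin n → ℝ), e.symm p = Fin.snoc p.2 p.1 := fun p => by
    simp [he_def, MeasurableEquiv.piFinSuccAbove, Fin.snocEquiv]
  -- membership in the restricted band, fibrewise
  have hmem : ∀ x t, Fin.snoc x t ∈ r.domain ∩ {z | Fin.init z ∈ S} ↔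
      x ∈ r'.domain ∩ S ∧ t ∈ Icc (a x) (b x) := by
    intro x t
    rw [hdom]
    simp only [mem_inter_iff, mem_setOf_eq, Fin.init_snoc, Fin.snoc_last, mem_Icc]
    tauto
  -- the integrand extended by zero off the restricted band, and its fibres
  set G : (Fin (n + 1) → ℝ) → ℝ := (r.domain ∩ {z | Fin.init z ∈ S}).indicator r.integrand with hG_def
  have hG : Integrable G :=
    (integrable_indicator_iff hbm).mpr (r.integrableOn.mono_set inter_subset_left)
  have hfib_in : ∀ x ∈ r'.domain ∩ S, (fun t => G (Fin.snoc x t)) =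
      (Icc (a x) (b x)).indicator (fun t => r.integrand (Fin.snoc x t)) := by
    intro x hx
    ext t
    by_cases ht : t ∈ Icc (a x) (b x)
    · rw [Set.indicator_of_mem ht, hG_def, Set.indicator_of_mem ((hmem x t).2 ⟨hx, ht⟩)]
    · rw [Set.indicator_of_notMem ht, hG_def,
        Set.indicator_of_notMem (fun h => ht ((hmem x t).1 h).2)]
  have hfib_out : ∀ x ∉ r'.domain ∩ S, (fun t => G (Fin.snoc x t)) = fun _ => 0 := by
    intro x hx
    ext t
    rw [hG_def, Set.indicator_of_notMem (fun h => hx ((hmem x t).1 h).1)]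
  have hG2 : Integrable (fun p : ℝ × (Fin n → ℝ) => G (Fin.snoc p.2 p.1))
      ((volume : Measure ℝ).prod (volume : Measure (Fin n → ℝ))) := by
    have h := ((he.symm e).integrable_comp_emb e.symm.measurableEmbedding (g := G)).mpr hG
    rw [← Measure.volume_eq_prod]
    convert h using 1
    ext p
    simp [he_symm]
  calc ∫ z in r.domain ∩ {z | Fin.init z ∈ S}, r.integrand z
      = ∫ z, G z := (integral_indicator hbm).symm
    _ = ∫ p, G (e.symm p) := ((he.symm e).integral_comp' G).symm
    _ = ∫ p : ℝ × (Fin n → ℝ), G (Fin.snoc p.2 p.1) ∂(volume.prod volume) := by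
        simp_rw [he_symm, Measure.volume_eq_prod]
    _ = ∫ x, ∫ t, G (Fin.snoc x t) := integral_prod_symm _ hG2
    _ = ∫ x, (r'.domain ∩ S).indicator
          (fun x => F (Fin.snoc x (b x)) - F (Fin.snoc x (a x))) x := by
        apply integral_congr_ae
        filter_upwards [hG2.prod_left_ae] with x hx
        by_cases hxτ : x ∈ r'.domain ∩ S
        · rw [Set.indicator_of_mem hxτ, hfib_in x hxτ, integral_indicator measurableSet_Icc,
            integral_Icc_eq_integral_Ioc, ← intervalIntegral.integral_of_le (hab x hxτ.1)]
          apply intervalIntegral.integral_eq_sub_of_hasDerivAt_of_le (hab x hxτ.1) (hcont x hxτ.1)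
            (hderiv x hxτ.1)
          rw [intervalIntegrable_iff_integrableOn_Icc_of_le (hab x hxτ.1)]
          have hx' : Integrable (fun t => G (Fin.snoc x t)) := hx
          rw [hfib_in x hxτ] at hx'
          exact (integrable_indicator_iff measurableSet_Icc).mp hx'
        · rw [Set.indicator_of_notMem hxτ]
          rw [hfib_out x hxτ, integral_zero]
    _ = ∫ x in r'.domain ∩ S, (F (Fin.snoc x (b x)) - F (Fin.snoc x (a x))) :=
        integral_indicator hτm

/-- A Newton–Leibniz move over a base of POSITIVE dimension preserves `Cdf` exactly: the first
coordinate is a base coordinate, so the half-space `{z₀ ≤ q}` is a cylinder over the base.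
[cite: KontsevichZagier2001, §1.2 rule (3)] -/
theorem Cdf_eq_of_newtonLeibniz_succ {m : ℕ} (r : IntegralRep (m + 1 + 1)) (r' : IntegralRep (m + 1))
    {a b : (Fin (m + 1) → ℝ) → ℝ} {F : (Fin (m + 1 + 1) → ℝ) → ℝ}
    (hab : ∀ x ∈ r'.domain, a x ≤ b x)
    (hdom : r.domain = {z | (Fin.init z : Fin (m + 1) → ℝ) ∈ r'.domain ∧
      a (Fin.init z) ≤ z (Fin.last (m + 1)) ∧ z (Fin.last (m + 1)) ≤ b (Fin.init z)})
    (hcont : ∀ x ∈ r'.domain, ContinuousOn (fun t : ℝ => F (Fin.snoc x t)) (Icc (a x) (b x)))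
    (hderiv : ∀ x ∈ r'.domain, ∀ t ∈ Ioo (a x) (b x),
      HasDerivAt (fun s : ℝ => F (Fin.snoc x s)) (r.integrand (Fin.snoc x t)) t)
    (hr' : ∀ x ∈ r'.domain, r'.integrand x = F (Fin.snoc x (b x)) - F (Fin.snoc x (a x))) :
    Cdf (of r) = Cdf (of r') := by
  funext q
  rw [Cdf_of_succ, Cdf_of_succ]
  have hS : MeasurableSet {x : Fin (m + 1) → ℝ | x 0 ≤ q} := measurableSet_halfWindow q (m + 1)
  have hset : r.domain ∩ {z : Fin (m + 1 + 1) → ℝ | z 0 ≤ q} =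
      r.domain ∩ {z | Fin.init z ∈ {x : Fin (m + 1) → ℝ | x 0 ≤ q}} := by
    ext z
    simp only [mem_inter_iff, mem_setOf_eq, Fin.init, Fin.castSucc_zero]
  rw [hset, setIntegral_band_restrict r r' hab hdom hcont hderiv hS]
  exact setIntegral_congr_fun ((IntegralRep.measurableSet_domain_holds r').inter hS)
    fun x hx => (hr' x hx.1).symm

end Summit.KontsevichZagierPeriods.CompleteModGammaSectorNegative
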